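import Summits.Ventures.DiscreteObjects.PP12.FlagTenCSeparates

/-!
# The `f = 10` flag-cell orbit data: `φ` is injective on the twelve vertices (kernel; Step C, conjunct 1 completed — `φ` is a permutation)
Framing: lottery ticket; floor = certified bounds/negative ranges.

Cell pub-namedobj (venture DiscreteObjects), target (M), designs gen 13 (HOME FAMILY-FLAG7X §7/§7b). Setting as in `FlagTenOrbitDataOfPlane`.
**`phiVertex_injective`**: two vertices `x₁, x₂` (points `≠ c` of `u₀`) inscribed in the same triangle coincide. Proof: their foreign sides are two
sides `F₁`, `F₂ = σʲF₁` of that triangle; `σʲx₁` and `x₂` are exterior points of `F₂` outside the triangle, and an exterior line carries exactly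
three exterior points (`FlagExterior.exterior_line_three_of_flag_ten`), two of which are the triangle's; so `σʲx₁ = x₂`, and a triangle has one
vertex on `u₀`. With `phiVertex_spec` / `phiVertex_no_two_cycle` (`FlagTenOrbitDataOfPlane`) this is conjunct 1 of `IsFlagTenOrbitMatrix` and makes
`φ` a permutation of the index set. No `sorry`, no new axioms.
-/

namespace Summit.Ventures.DiscreteObjects.PP12

open Configuration Finset
open scoped Classical

namespace Collineation

variable {P L : Type*} [Membership P L] [ProjectivePlane P L] [Fintype P] [Fintype L] (σ : Collineation P L)

section Flag

variable {l : L} {c : P} (hl : σ.onLines l = l) (hc : σ.onPoints c = c) (hcl : c ∈ l)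
  (hP : ∀ p : P, σ.onPoints p = p → p ∈ l) (hL : ∀ m : L, σ.onLines m = m → c ∈ m)
  (h12 : ProjectivePlane.order P L = 12)

include hl hc hcl hP hL h12 in
/-- **An exterior line carries at most one exterior point outside the triangle it is a side of** (`f = 10`): if `Q, σQ ∈ F` (`Q` exterior) and
`p, p' ∈ F` are exterior points not in `orb3 Q`, then `p = p'`. -/
theorem odd_point_unique (hq : σ.onPoints ^ 3 = 1) (hf : fixedCard σ.onPoints = 10) {Q : P}
    (hQ : σ.onPoints Q ≠ Q ∧ ∀ m : L, σ.onLines m = m → Q ∉ m) {F : L} (hQF : Q ∈ F) (hσQF : σ.onPoints Q ∈ F)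
    {p p' : P} (hp : σ.onPoints p ≠ p ∧ ∀ m : L, σ.onLines m = m → p ∉ m) (hpF : p ∈ F) (hpQ : p ∉ orb3 σ.onPoints Q)
    (hp' : σ.onPoints p' ≠ p' ∧ ∀ m : L, σ.onLines m = m → p' ∉ m) (hp'F : p' ∈ F) (hp'Q : p' ∉ orb3 σ.onPoints Q) : p = p' := by
  obtain ⟨hnF, hF0⟩ := σ.side_no_fixed_point hQ.1 hQ.2 hQF hσQF
  obtain ⟨h3, -⟩ := σ.exterior_line_three_of_flag_ten hl hc hcl hP hL h12 hq hf hnF hF0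
  set S : Finset P := univ.filter fun R : P => R ∈ F ∧ σ.onPoints R ≠ R ∧ ∀ m : L, σ.onLines m = m → R ∉ m with hS
  by_contra hne
  have hQσQ : Q ≠ σ.onPoints Q := fun e => hQ.1 e.symm
  have hQm : Q ∈ orb3 σ.onPoints Q := self_mem_orb3 _ _
  have hσQm : σ.onPoints Q ∈ orb3 σ.onPoints Q := (mem_orb3 _ _ _).2 (Or.inr (Or.inl rfl))
  have hpQ' : p ≠ Q := fun e => hpQ (e ▸ hQm)
  have hpσQ : p ≠ σ.onPoints Q := fun e => hpQ (e ▸ hσQm)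
  have hp'Q' : p' ≠ Q := fun e => hp'Q (e ▸ hQm)
  have hp'σQ : p' ≠ σ.onPoints Q := fun e => hp'Q (e ▸ hσQm)
  have hσQX : σ.onPoints (σ.onPoints Q) ≠ σ.onPoints Q ∧ ∀ m : L, σ.onLines m = m → σ.onPoints Q ∉ m :=
    ⟨fun e => hQ.1 (σ.onPoints.injective e), σ.exterior_map hQ.2⟩
  have hsub : ({Q, σ.onPoints Q, p, p'} : Finset P) ⊆ S := by
    intro z hz
    simp only [mem_insert, mem_singleton] at hz
    rw [hS, mem_filter]
    rcases hz with rfl | rfl | rfl | rfl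
    · exact ⟨mem_univ _, hQF, hQ⟩
    · exact ⟨mem_univ _, hσQF, hσQX⟩
    · exact ⟨mem_univ _, hpF, hp⟩
    · exact ⟨mem_univ _, hp'F, hp'⟩
  have hn1 : Q ∉ ({σ.onPoints Q, p, p'} : Finset P) := by
    simp only [mem_insert, mem_singleton, not_or]; exact ⟨hQσQ, hpQ'.symm, hp'Q'.symm⟩
  have hn2 : σ.onPoints Q ∉ ({p, p'} : Finset P) := by
    simp only [mem_insert, mem_singleton, not_or]; exact ⟨hpσQ.symm, hp'σQ.symm⟩
  have h4 : ({Q, σ.onPoints Q, p, p'} : Finset P).card = 4 := by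
    rw [card_insert_of_notMem hn1, card_insert_of_notMem hn2, card_pair hne]
  have := card_le_card hsub
  rw [h4, h3] at this
  omega

include hl hc hcl hP hL h12 in
/-- **`φ` is injective** (`f = 10`): two vertices on `u₀` inscribed in the same triangle are equal. -/
theorem phiVertex_injective (hq : σ.onPoints ^ 3 = 1) (hf : fixedCard σ.onPoints = 10) {u₀ : L} (hcu₀ : c ∈ u₀) (hu₀ : σ.onLines u₀ ≠ u₀)
    {x₁ x₂ : P} (h₁u : x₁ ∈ u₀) (h₁c : x₁ ≠ c) (h₂u : x₂ ∈ u₀) (h₂c : x₂ ≠ c)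
    (h : σ.phiVertex l c u₀ x₁ = σ.phiVertex l c u₀ x₂) : x₁ = x₂ := by
  have hqL : σ.onLines ^ 3 = 1 := σ.onLines_pow_eq_one hq
  have h₁X := σ.exterior_of_mem_cline hL hcu₀ hu₀ h₁u h₁c
  have h₂X := σ.exterior_of_mem_cline hL hcu₀ hu₀ h₂u h₂c
  have h₁f : σ.onPoints x₁ ≠ x₁ := σ.not_fixed_of_exterior_flag hl hP h₁X
  have h₂f : σ.onPoints x₂ ≠ x₂ := σ.not_fixed_of_exterior_flag hl hP h₂X
  obtain ⟨hx'u, hx'c, ⟨Q₁, hQ₁x', hQ₁F, hσQ₁F⟩, hne₁⟩ := σ.phiVertex_spec hl hc hcl hP hL h12 hq hf hcu₀ hu₀ h₁X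
  obtain ⟨-, -, ⟨Q₂, hQ₂x', hQ₂F, hσQ₂F⟩, hne₂⟩ := σ.phiVertex_spec hl hc hcl hP hL h12 hq hf hcu₀ hu₀ h₂X
  rw [← h] at hQ₂x' hne₂
  set x' := σ.phiVertex l c u₀ x₁ with hx'_def
  obtain ⟨h₁F, -, -, -⟩ := σ.foreignSide_spec hl hP h12 hq hf h₁X
  obtain ⟨h₂F, -, -, -⟩ := σ.foreignSide_spec hl hP h12 hq hf h₂X
  set F₁ := σ.foreignSide l x₁
  set F₂ := σ.foreignSide l x₂
  have hx'X := σ.exterior_of_mem_cline hL hcu₀ hu₀ hx'u hx'c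
  have hx'f : σ.onPoints x' ≠ x' := σ.not_fixed_of_exterior_flag hl hP hx'X
  have hQ₁X := σ.exterior_of_mem_orb3 hx'X hQ₁x'
  have hQ₂X := σ.exterior_of_mem_orb3 hx'X hQ₂x'
  have hQ₁f : σ.onPoints Q₁ ≠ Q₁ := σ.not_fixed_of_exterior_flag hl hP hQ₁X
  have hQ₂f : σ.onPoints Q₂ ≠ Q₂ := σ.not_fixed_of_exterior_flag hl hP hQ₂X
  -- both foreign sides are sides of the triangle of x'
  have hF₁o : F₁ ∈ orb3 σ.onLines (σ.sideOf l x') := σ.mem_orb3_sideOf_of_side hq hx'f hQ₁x' hQ₁f hQ₁F hσQ₁F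
  have hF₂o : F₂ ∈ orb3 σ.onLines (σ.sideOf l x') := σ.mem_orb3_sideOf_of_side hq hx'f hQ₂x' hQ₂f hQ₂F hσQ₂F
  have hF₂F₁ : F₂ ∈ orb3 σ.onLines F₁ := by rw [orb3_eq_of_mem σ.onLines hqL hF₁o]; exact hF₂o
  -- the image p of x₁ lying on F₂
  obtain ⟨p, hpx₁, hpF₂⟩ : ∃ p ∈ orb3 σ.onPoints x₁, p ∈ F₂ := by
    rw [mem_orb3] at hF₂F₁
    rcases hF₂F₁ with e | e | e
    · exact ⟨x₁, self_mem_orb3 _ _, by rw [e]; exact h₁F⟩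
    · exact ⟨σ.onPoints x₁, (mem_orb3 _ _ _).2 (Or.inr (Or.inl rfl)), by rw [e]; exact σ.mem_map h₁F⟩
    · exact ⟨σ.onPoints (σ.onPoints x₁), (mem_orb3 _ _ _).2 (Or.inr (Or.inr rfl)), by rw [e]; exact σ.mem_map (σ.mem_map h₁F)⟩
  have hpX := σ.exterior_of_mem_orb3 h₁X hpx₁
  have hpf : σ.onPoints p ≠ p := σ.not_fixed_of_exterior_flag hl hP hpX
  -- orbits of x₁, x₂ are disjoint from the orbit of x' (= orbit of Q₂)
  have hQ₂o : orb3 σ.onPoints Q₂ = orb3 σ.onPoints x' := orb3_eq_of_mem σ.onPoints hq hQ₂x'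
  have disj : ∀ {z w : P}, z ∈ orb3 σ.onPoints w → orb3 σ.onPoints x' ≠ orb3 σ.onPoints w → z ∉ orb3 σ.onPoints Q₂ := by
    intro z w hz hw hzQ
    exact hw ((hQ₂o.symm.trans (orb3_eq_of_mem σ.onPoints hq hzQ).symm).trans (orb3_eq_of_mem σ.onPoints hq hz))
  have hpQ : p ∉ orb3 σ.onPoints Q₂ := disj hpx₁ hne₁
  have hx₂Q : x₂ ∉ orb3 σ.onPoints Q₂ := disj (self_mem_orb3 _ _) hne₂
  -- hence p = x₂, so x₂ ∈ orb3 x₁ and both lie on u₀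
  have hpx₂ : p = x₂ := σ.odd_point_unique hl hc hcl hP hL h12 hq hf ⟨hQ₂f, hQ₂X⟩ hQ₂F hσQ₂F ⟨hpf, hpX⟩ hpF₂ hpQ ⟨h₂f, h₂X⟩ h₂F hx₂Q
  rw [hpx₂] at hpx₁
  have hle := σ.card_orb3_inter_cline_le_one hc hq hcu₀ hu₀ x₁
  by_contra hne
  have h2 : 2 ≤ ((orb3 σ.onPoints x₁).filter fun q => q ∈ u₀).card := by
    have hsub : ({x₁, x₂} : Finset P) ⊆ (orb3 σ.onPoints x₁).filter fun q => q ∈ u₀ := by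
      intro z hz; rw [mem_insert, mem_singleton] at hz; rw [mem_filter]
      rcases hz with rfl | rfl
      · exact ⟨self_mem_orb3 _ _, h₁u⟩
      · exact ⟨hpx₁, h₂u⟩
    have := card_le_card hsub; rwa [card_pair hne] at this
  omega

end Flag

end Collineation

end Summit.Ventures.DiscreteObjects.PP12
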